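import Literature.Geometry.Lorentzian.KerrSchildHomogeneity
import Literature.Geometry.Lorentzian.ChartSecondFundamentalForm

/-!
# The slice dilation maps `Kerr.slice a r₀ ≃ Kerr.slice (la) (l r₀)`

The dilation `y ↦ l y` of `ℝ³` (`l > 0`) maps the Kerr–Schild slice `Kerr.slice a r₀ = {r_a(0, y) > r₀}`
onto the slice `Kerr.slice (la) (l r₀)` of the dilated parameters (`Kerr.mem_slice_dilate_iff`,
`KerrSchildHomogeneity.lean`: the Kerr–Schild radius is homogeneous of degree one). This file
packages the two mutually inverse maps as functions between the slice SUBTYPES — the form in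
which a Kerr-shielding chart `φ : Kerr.slice a r₁ → X` is transported to the dilated parameters,
`z ↦ l • φ (z / l)`:

* `Kerr.sliceShrink l hl a r₀ : slice (la) (l r₀) → slice a r₀`, `z ↦ z / l`, and its inverse
  `Kerr.sliceScale` (`y ↦ l y`); the homeomorphism `Kerr.sliceShrinkHomeomorph`;
* `Kerr.contMDiff_sliceShrink`, `Kerr.mfderiv_sliceShrink_apply` — the contraction is smooth with
  differential `v ↦ v / l` (maps between chart domains, `OpensChart.mfderiv_apply_of_repr`);
* `E4.ofTimeSpace_zero_smul` — `(0, l y) = l (0, y)`.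

Everything is proved; the homogeneity facts themselves are the tree's (`Kerr.radius_smul`,
`Kerr.bilin_dilate`, `Kerr.mem_region_dilate_iff`, `Kerr.mem_slice_dilate_iff`, `Kerr.rPlus_dilate`).

## References

* R. P. Kerr, A. Schild, *A new class of vacuum solutions of the Einstein field equations*
  (1965), §2. [KerrSchild1965]
* M. Visser, *The Kerr spacetime: a brief introduction*, arXiv:0706.0622, (32)–(35). [arXiv07060622]
-/

noncomputable section

open Set Function TopologicalSpace
open scoped Manifold ContDiff Topology

namespace Literature.Geometry.Lorentzian

namespace E4

/-- A point of the slice `t = 0` depends linearly on its space part: `(0, l y) = l • (0, y)`.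
[folklore] -/
theorem ofTimeSpace_zero_smul (l : ℝ) (y : E3) : ofTimeSpace 0 (l • y) = l • ofTimeSpace 0 y := by
  rw [Kerr.smul_ofTimeSpace, mul_zero]

end E4

namespace Kerr

variable {l : ℝ} (hl : 0 < l)
include hl

/-- `l⁻¹ z ∈ slice a r₀ ↔ z ∈ slice (la) (l r₀)` (`mem_slice_dilate_iff` at the point `l⁻¹ z`).
[cite: arXiv07060622, (35)] -/
theorem inv_smul_mem_slice_iff {a r₀ : ℝ} {z : E3} :
    l⁻¹ • z ∈ slice a r₀ ↔ z ∈ slice (l * a) (l * r₀) := by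
  rw [← mem_slice_dilate_iff hl (y := l⁻¹ • z), smul_smul, mul_inv_cancel₀ hl.ne', one_smul]

omit hl in
variable (l) in
/-- **The slice contraction** `slice (la) (l r₀) → slice a r₀`, `z ↦ z / l` (`l > 0`).
[cite: arXiv07060622, (35)] -/
def sliceShrink (hl : 0 < l) (a r₀ : ℝ) (z : slice (l * a) (l * r₀)) : slice a r₀ :=
  ⟨l⁻¹ • (z : E3), (inv_smul_mem_slice_iff hl).2 z.2⟩

omit hl in
variable (l) in
/-- **The slice dilation** `slice a r₀ → slice (la) (l r₀)`, `y ↦ l y` (`l > 0`).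
[cite: arXiv07060622, (35)] -/
def sliceScale (hl : 0 < l) (a r₀ : ℝ) (y : slice a r₀) : slice (l * a) (l * r₀) :=
  ⟨l • (y : E3), (mem_slice_dilate_iff hl).2 y.2⟩

/-- `sliceShrink` in coordinates: `z ↦ l⁻¹ z`. [folklore] -/
@[simp]
theorem coe_sliceShrink {a r₀ : ℝ} (z : slice (l * a) (l * r₀)) :
    (sliceShrink l hl a r₀ z : E3) = l⁻¹ • (z : E3) := rfl

/-- `sliceScale` in coordinates: `y ↦ l y`. [folklore] -/
@[simp]
theorem coe_sliceScale {a r₀ : ℝ} (y : slice a r₀) : (sliceScale l hl a r₀ y : E3) = l • (y : E3) := rfl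

/-- `sliceShrink ∘ sliceScale = id`. [folklore] -/
theorem sliceShrink_sliceScale {a r₀ : ℝ} (y : slice a r₀) :
    sliceShrink l hl a r₀ (sliceScale l hl a r₀ y) = y :=
  Subtype.ext (show l⁻¹ • (l • (y : E3)) = y by rw [smul_smul, inv_mul_cancel₀ hl.ne', one_smul])

/-- `sliceScale ∘ sliceShrink = id`. [folklore] -/
theorem sliceScale_sliceShrink {a r₀ : ℝ} (z : slice (l * a) (l * r₀)) :
    sliceScale l hl a r₀ (sliceShrink l hl a r₀ z) = z :=
  Subtype.ext (show l • (l⁻¹ • (z : E3)) = z by rw [smul_smul, mul_inv_cancel₀ hl.ne', one_smul])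

omit hl in
variable (l) in
/-- The slice contraction as a homeomorphism `slice (la) (l r₀) ≃ₜ slice a r₀` (inverse: the slice
dilation). [folklore] -/
def sliceShrinkHomeomorph (hl : 0 < l) (a r₀ : ℝ) : slice (l * a) (l * r₀) ≃ₜ slice a r₀ where
  toFun := sliceShrink l hl a r₀
  invFun := sliceScale l hl a r₀
  left_inv := sliceScale_sliceShrink hl
  right_inv := sliceShrink_sliceScale hl
  continuous_toFun := ((continuous_const_smul l⁻¹).comp continuous_subtype_val).subtype_mk _
  continuous_invFun := ((continuous_const_smul l).comp continuous_subtype_val).subtype_mk _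

/-- The slice contraction is surjective. [folklore] -/
theorem sliceShrink_surjective (a r₀ : ℝ) : Surjective (sliceShrink l hl a r₀) :=
  (sliceShrinkHomeomorph l hl a r₀).surjective

/-- The slice contraction is smooth (a restriction of the linear map `l⁻¹ • id`). [folklore] -/
theorem contMDiff_sliceShrink (a r₀ : ℝ) : ContMDiff 𝓘(ℝ, E3) 𝓘(ℝ, E3) ∞ (sliceShrink l hl a r₀) :=
  (ContMDiff.subtypeVal_comp_iff _ _).1
    ((l⁻¹ • ContinuousLinearMap.id ℝ E3).contDiff.contMDiff.comp contMDiff_subtype_val)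

/-- The differential of the slice contraction is `v ↦ l⁻¹ v`. [folklore] -/
theorem mfderiv_sliceShrink_apply {a r₀ : ℝ} (z : slice (l * a) (l * r₀)) (v : E3) :
    mfderiv 𝓘(ℝ, E3) 𝓘(ℝ, E3) (sliceShrink l hl a r₀) z v = l⁻¹ • v := by
  rw [OpensChart.mfderiv_apply_of_repr (f := sliceShrink l hl a r₀) (Φ := fun y : E3 ↦ l⁻¹ • y)
    (fun y ↦ rfl) ((l⁻¹ • ContinuousLinearMap.id ℝ E3).differentiableAt)]
  exact congrFun (congrArg DFunLike.coe (l⁻¹ • ContinuousLinearMap.id ℝ E3).fderiv) v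

end Kerr

end Literature.Geometry.Lorentzian

end
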